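import Summits.CriticalPhenomena.PercolationContinuityZ3.Theorems.PercNearOneGluingNoHeavyLowerTailSunflowerCloneGamma
import Summits.CriticalPhenomena.PercolationContinuityZ3.Theorems.PercNearOneGluingNoHeavyLowerTailSunflowerSpectatorRows
import HarnessLib

/-!
# `NoHeavyLowerTail` (crux stmt-CriticalPhenomena-4575): the WEAKEST partition lemma `PartitionLemmaT` already implies Sahi's `E₃ ≥ 0` on the
# complements of every sunflower of monotone events — hence the E3GRP row `γ` (`GammaRow`), `r4`, `r6`

Support file (seat `prim-ineq-prove-1` gen 27; `--supports stmt-CriticalPhenomena-4575`; after `…SunflowerSpectatorRows` (this seat) and prim-l12-p2's clone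
calculus `…SunflowerCloneCalculus/Ops/Transfer/Law/Hqt/Gamma`).  No `sorry`, no named facts; the only hypothesis is the typed conjecture `PartitionLemmaT`
(`…SunflowerSpectatorRows`), an obligation of the programme, never a fact.  Memo: run/shared/lean/prim/prim-ineq-prove-1/SPECTATOR-ROWS-prove1-g27.md.

WHY.  prim-l12-p2 proved `gammaRow_of_partitionLemmaH : PartitionLemmaH → GammaRow` by transferring the `H`-row and adding Gladkov's `(1 − b)·AG ≥ 0`.  But
`γ` IS the `T`-row `(1 + a)(ab − e₂) − e₃ = E₃(E₁ᶜ,E₂ᶜ,E₃ᶜ)` (`Literature…sahiE3_compl_sunflower_eq`), and the transfer theorem `Mk_bern_nonneg_of_Zk_nonneg` is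
kernel-generic: transferring the `T`-kernel `s6T` directly needs only `PartitionLemmaT`, which is implied by `PartitionLemmaH` (`partitionLemmaT_of_H`,
difference `= 3·(petal-spectator + kernel-spectator antipodal-Gladkov sums) ≥ 0`) and is the weakest of the three census-true partition lemmas.  So the
counting statement a prover has to establish for `γ` is:  `Σ_{X ⊆ E} σ(E∖X) + Σ_{X ∈ A} σ(E∖X) ≥ 2·N₁₂₃`  (all spectators, kernel spectators twice).

* `sum_s6T_mass_eq` — the cubic form of `s6T` is `6·((σ + a)(ab − e₂(c)) − e₃(c))`, `σ = Σ` masses;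
* `Zk_eq_sum_parts` — (kernel-generic) the clone-calculus partition functional `Zk κ` is the sum of `κ` over `parts`; `Zk_s6T_eq_ZT`;
* `lawT_mass_nonneg_of_partitionLemmaT`, `lawT_real_nonneg_of_partitionLemmaT` — `PartitionLemmaT ⇒ 0 ≤ (1 + a)(ab − e₂) − e₃` for every sunflower of
  up-sets under every product measure on a finite cube (`Σ` masses `= 1`: `sum_wP_coe_eq_one`);
* `sahiE3_compl_sunflower_nonneg_of_partitionLemmaT`, `sahiE3_compl_lowerSunflower_nonneg_of_partitionLemmaT` (reflection `p ↦ 1 − p`);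
* **`gammaRow_of_partitionLemmaT : PartitionLemmaT → GammaRow`**, `rowHolds_four_of_partitionLemmaT`, `rowHolds_six_of_partitionLemmaT`.
-/

noncomputable section

namespace Summit.CriticalPhenomena.PercolationContinuityZ3.Theorems.SunflowerPartition

open Finset MeasureTheory
open Literature.Probability.LatticeModels Literature.Probability.Percolation Literature.Probability.Percolation.DecisionTree

/-! ### The kernel `s6T` in the clone calculus -/

/-- The real-valued `s6T`. [this work] -/
def s6Tr : Fin 5 → Fin 5 → Fin 5 → ℝ := fun x y z => (s6T x y z : ℝ)

/-- **The cubic form of `s6T` is `6·T`**, `T = (σ + a)(ab − e₂(c)) − e₃(c)` with `a = m 4`, `b = m 0`, `c = (m 1, m 2, m 3)`, `σ = Σ_v m v`.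
[this work] -/
theorem sum_s6T_mass_eq (m : Fin 5 → ℝ) :
    ∑ x : Fin 5, ∑ y : Fin 5, ∑ z : Fin 5, m x * m y * m z * s6Tr x y z =
      6 * (((m 0 + m 1 + m 2 + m 3 + m 4) + m 4) * (m 4 * m 0 - (m 1 * m 2 + m 1 * m 3 + m 2 * m 3)) - m 1 * m 2 * m 3) := by
  simp only [s6Tr, s6T_table, Fin.sum_univ_five]
  simp only [Matrix.cons_val_zero, Matrix.cons_val_one, Matrix.cons_val]
  norm_num
  ring

section Partition

variable {E : Type*} [Fintype E] [DecidableEq E]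

/-- **Kernel-generic**: the clone-calculus partition functional `Zk κ` is the sum of `κ` over ordered 3-partitions (`parts`). [this work] -/
theorem Zk_eq_sum_parts (κ : Fin 5 → Fin 5 → Fin 5 → ℝ) (lab : Finset E → Fin 5) :
    Zk κ lab = ∑ q ∈ parts E, κ (lab q.1) (lab q.2) (lab (q.1 ∪ q.2)ᶜ) := by
  unfold Zk Mk
  simp_rw [prod_cl1_eq, ite_mul, one_mul, zero_mul]
  rw [← sum_filter]
  refine sum_nbij' (fun β => (blocks β 0, blocks β 1))
    (fun q => fun e => (decide (e ∈ q.1), decide (e ∈ q.2), decide (e ∉ q.1 ∧ e ∉ q.2))) ?_ ?_ ?_ ?_ ?_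
  · intro β hβ
    rw [mem_filter] at hβ
    unfold parts
    rw [mem_filter]
    exact ⟨mem_univ _, (blocks_two_eq_of_single hβ.2).2⟩
  · intro q hq
    unfold parts at hq
    rw [mem_filter] at hq
    rw [mem_filter]
    refine ⟨mem_univ _, fun e => ?_⟩
    have hd := hq.2
    rw [Finset.disjoint_left] at hd
    by_cases h1 : e ∈ q.1
    · have h2 : e ∉ q.2 := hd h1
      simp [h1, h2, Pat.isSingle]
    · by_cases h2 : e ∈ q.2 <;> simp [h1, h2, Pat.isSingle]
  · intro β hβ
    rw [mem_filter] at hβ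
    funext e
    have he := hβ.2 e
    have : (β e).2.2 = (!(β e).1 && !(β e).2.1) := by
      revert he; rcases β e with ⟨_ | _, _ | _, _ | _⟩ <;> simp [Pat.isSingle]
    ext <;> simp [this]
  · intro q hq
    ext e <;> simp [Pat.bit]
  · intro β hβ
    rw [mem_filter] at hβ
    obtain ⟨h2, _⟩ := blocks_two_eq_of_single hβ.2
    simp only [h2]

/-- The clone-calculus partition functional with kernel `s6T` is `Sunflower.ZT`. [this work] -/
theorem Zk_s6T_eq_ZT (F : Sunflower E) : Zk s6Tr F.lab = (F.ZT : ℝ) := by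
  rw [Zk_eq_sum_parts]
  unfold Sunflower.ZT
  rw [Int.cast_sum]
  rfl

/-- `PartitionLemmaT` supplies the hypothesis of the transfer theorem for the kernel `s6T`. [this work] -/
theorem Zk_s6T_nonneg_of_partitionLemmaT (h : PartitionLemmaT) (E : Type) [Fintype E] [DecidableEq E] (F : Sunflower E) :
    0 ≤ Zk s6Tr F.lab := by
  rw [Zk_s6T_eq_ZT]
  exact_mod_cast h E F

/-- The cell masses add up to the total product-measure weight. [this work] -/
theorem sum_mass_eq (lab : Finset E → Fin 5) (p : E → ℝ) : ∑ v : Fin 5, mass lab p v = ∑ S : Finset E, wP p S := by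
  have h := sum_wP_lab lab p (fun _ => 1)
  simp only [mul_one] at h
  exact h.symm

/-- **Law-level `T` from `PartitionLemmaT`, every sunflower, every product measure** (homogeneous form, `σ = Σ_S w_p(S)`):
`0 ≤ (σ + a)(ab − e₂(c)) − e₃(c)` for the cell masses. [this work] -/
theorem lawT_mass_nonneg_of_partitionLemmaT (h : PartitionLemmaT) (F : Sunflower E) (p : E → ℝ) (hp : ∀ x, 0 ≤ p x ∧ p x ≤ 1) :
    0 ≤ ((∑ S : Finset E, wP p S) + mass F.lab p 4) *
        (mass F.lab p 4 * mass F.lab p 0 -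
          (mass F.lab p 1 * mass F.lab p 2 + mass F.lab p 1 * mass F.lab p 3 + mass F.lab p 2 * mass F.lab p 3)) -
        mass F.lab p 1 * mass F.lab p 2 * mass F.lab p 3 := by
  have h6 := Mk_bern_nonneg_of_Zk_nonneg s6Tr (Zk_s6T_nonneg_of_partitionLemmaT h) F p hp
  rw [Mk_bern_eq_cubic, sum_s6T_mass_eq] at h6
  rw [← sum_mass_eq, Fin.sum_univ_five]
  linarith

end Partition

/-! ### Measure level: every sunflower of up-sets under `prodBernoulli` -/

section SetSunflower

variable {ι : Type*} [Fintype ι] [DecidableEq ι]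

/-- The product-measure weights of all configurations add up to `1`. [folklore] -/
theorem sum_wP_coe_eq_one (p : ι → unitInterval) : ∑ S : Finset ι, wP (fun i => (p i : ℝ)) S = 1 := by
  have h := prodBernoulli_real_eq_sum_wP p Set.univ
  simp only [Set.mem_univ, if_true] at h
  rw [← h, probReal_univ]

/-- **`PartitionLemmaT ⇒` the `T`-row at MEASURE level**: for every product measure on a finite cube and every sunflower of up-sets,
`0 ≤ (1 + a)(ab − e₂(c)) − e₃(c)`. [this work] -/
theorem lawT_real_nonneg_of_partitionLemmaT (h : PartitionLemmaT) (p : ι → unitInterval) {E₁ E₂ E₃ : Set (Set ι)}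
    (h₁ : IsUpperSet E₁) (h₂ : IsUpperSet E₂) (h₃ : IsUpperSet E₃) {A : Set (Set ι)}
    (h12 : E₁ ∩ E₂ = A) (h13 : E₁ ∩ E₃ = A) (h23 : E₂ ∩ E₃ = A) :
    0 ≤ (1 + (prodBernoulli p).real A) *
          ((prodBernoulli p).real A * (prodBernoulli p).real (E₁ ∪ E₂ ∪ E₃)ᶜ -
            ((prodBernoulli p).real (E₁ \ A) * (prodBernoulli p).real (E₂ \ A) +
              (prodBernoulli p).real (E₁ \ A) * (prodBernoulli p).real (E₃ \ A) +
              (prodBernoulli p).real (E₂ \ A) * (prodBernoulli p).real (E₃ \ A))) -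
        (prodBernoulli p).real (E₁ \ A) * (prodBernoulli p).real (E₂ \ A) * (prodBernoulli p).real (E₃ \ A) := by
  have h0 := lawT_mass_nonneg_of_partitionLemmaT h (setSunflower E₁ E₂ E₃ h₁ h₂ h₃ h12 h13 h23) (fun i => (p i : ℝ))
    fun i => ⟨(p i).2.1, (p i).2.2⟩
  obtain ⟨e4, e0, e1, e2, e3⟩ := mass_setSunflower h₁ h₂ h₃ h12 h13 h23 p
  rw [e4, e0, e1, e2, e3, sum_wP_coe_eq_one] at h0
  exact h0

/-- **`PartitionLemmaT ⇒ E₃ ≥ 0` on the complements of every sunflower of UP-SETS, every product measure**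
(`E₃(E₁ᶜ,E₂ᶜ,E₃ᶜ) = (1+a)(ab − e₂) − e₃`, no Gladkov step needed). [this work] -/
theorem sahiE3_compl_sunflower_nonneg_of_partitionLemmaT (h : PartitionLemmaT) (p : ι → unitInterval) {E₁ E₂ E₃ : Set (Set ι)}
    (h₁ : IsUpperSet E₁) (h₂ : IsUpperSet E₂) (h₃ : IsUpperSet E₃) {A : Set (Set ι)}
    (h12 : E₁ ∩ E₂ = A) (h13 : E₁ ∩ E₃ = A) (h23 : E₂ ∩ E₃ = A) :
    0 ≤ sahiE3 (prodBernoulli p) E₁ᶜ E₂ᶜ E₃ᶜ := by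
  rw [sahiE3_compl_sunflower_eq (μ := prodBernoulli p) MeasurableSet.of_discrete MeasurableSet.of_discrete MeasurableSet.of_discrete
    h12 h13 h23]
  exact lawT_real_nonneg_of_partitionLemmaT h p h₁ h₂ h₃ h12 h13 h23

end SetSunflower

section LowerSunflower

variable {ι : Type*} [Fintype ι] [DecidableEq ι]

/-- **Decreasing form**: `PartitionLemmaT ⇒ 0 ≤ E₃(D₁ᶜ, D₂ᶜ, D₃ᶜ)` for every sunflower of DOWN-sets under every product measure
(reflection `p ↦ 1 − p`). [this work] -/
theorem sahiE3_compl_lowerSunflower_nonneg_of_partitionLemmaT (h : PartitionLemmaT) (p : ι → unitInterval) {K D₁ D₂ D₃ : Set (Set ι)}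
    (h₁ : IsLowerSet D₁) (h₂ : IsLowerSet D₂) (h₃ : IsLowerSet D₃) (h12 : D₁ ∩ D₂ = K) (h13 : D₁ ∩ D₃ = K) (h23 : D₂ ∩ D₃ = K) :
    0 ≤ sahiE3 (prodBernoulli p) D₁ᶜ D₂ᶜ D₃ᶜ := by
  rw [sahiE3_eq_sahiE3_preimage_compl p MeasurableSet.of_discrete MeasurableSet.of_discrete MeasurableSet.of_discrete,
    Set.preimage_compl, Set.preimage_compl, Set.preimage_compl]
  exact sahiE3_compl_sunflower_nonneg_of_partitionLemmaT h _ (isUpperSet_preimage_compl h₁) (isUpperSet_preimage_compl h₂)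
    (isUpperSet_preimage_compl h₃) (by rw [← Set.preimage_inter, h12]) (by rw [← Set.preimage_inter, h13])
    (by rw [← Set.preimage_inter, h23])

end LowerSunflower

/-! ### The E3GRP row `γ` from `PartitionLemmaT` -/

section Gamma

variable {V : Type*}

/-- **`PartitionLemmaT ⇒ γ`** (`GammaRow`: `0 ≤ E₃(lnk[ab|cy], lnk[ac|by], lnk[ay|bc])` on every finite weighted graph) — the WEAKEST of the three
partition lemmas suffices. [this work] -/
theorem gammaRow_of_partitionLemmaT (h : PartitionLemmaT) : GammaRow := by
  intro V _ w a b c y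
  classical
  obtain ⟨e13, e23⟩ := groupSep_matchings_inter a b c y
  rw [groupConn_eq_compl_groupSep, groupConn_eq_compl_groupSep, groupConn_eq_compl_groupSep]
  exact sahiE3_compl_lowerSunflower_nonneg_of_partitionLemmaT h w
    (Literature.Combinatorics.Sahi2008.isLowerSet_groupSep _ _) (Literature.Combinatorics.Sahi2008.isLowerSet_groupSep _ _)
    (Literature.Combinatorics.Sahi2008.isLowerSet_groupSep _ _) rfl e13.symm (e23.trans e13.symm)

/-- `PartitionLemmaT ⇒ r4` (the five-terminal E3GRP row `RowHolds 4`). [this work] -/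
theorem rowHolds_four_of_partitionLemmaT (h : PartitionLemmaT) {n : ℕ} (w : Sym2 (Fin n) → unitInterval) (t : E3GroupSepCert.Tup n) :
    E3GroupSepCert.RowHolds 4 w t :=
  CoSunflowerGlue.rowHolds_four_of_gammaRow (gammaRow_of_partitionLemmaT h) w t

/-- `PartitionLemmaT ⇒ r6` (the five-terminal E3GRP row `RowHolds 6`). [this work] -/
theorem rowHolds_six_of_partitionLemmaT (h : PartitionLemmaT) {n : ℕ} (w : Sym2 (Fin n) → unitInterval) (t : E3GroupSepCert.Tup n) :
    E3GroupSepCert.RowHolds 6 w t :=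
  CoSunflowerGlue.rowHolds_six_of_gammaRow (gammaRow_of_partitionLemmaT h) w t

/-- Hence also `PartitionLemmaG ⇒ γ` and (again) `PartitionLemmaH ⇒ γ` through the chain `H ⇒ G ⇒ T`. [this work] -/
theorem gammaRow_of_partitionLemmaG (h : PartitionLemmaG) : GammaRow :=
  gammaRow_of_partitionLemmaT (partitionLemmaT_of_G h)

end Gamma

end Summit.CriticalPhenomena.PercolationContinuityZ3.Theorems.SunflowerPartition

end
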